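import Mathlib
import Summits.Ventures.PercRepro2.MeasureBridgeCylinder

/-!
# Percolation on an arbitrary edge set as Mathlib's infinite product of Bernoulli laws
(blind cell PercRepro2, typer-1 g15, 2026-08-26)

`percMeasureInf p := Measure.infinitePi (fun e => edgeLaw (p e))` is the product Bernoulli measure
on the configurations `ι → Bool` of an ARBITRARY edge type `ι` (infinite allowed), with edge
weights `p : ι → I` — Mathlib's `infinitePi` (the Ionescu-Tulcea / Kolmogorov product of
probability measures).  This file records:

* `percMeasureInf_eq_percMeasure` — on a finite edge type it is `percMeasure p` (`MeasureBridge`);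
* `percMeasureInf_cylinder` / `percMeasureInf_real_cylinder` — for a finite edge set `u` and an
  event `S` of the configurations on `u`, the cylinder event has probability
  `prob (fun e : u => p e) S`: the cell's finite sums ARE the finite-dimensional marginals of the
  product measure on any graph, with arbitrary (non-constant) edge weights;
* `map_eval_percMeasureInf` (marginals), `iIndepFun_percMeasureInf` (independence of the edges);
* `setBernoulli_univ_eq_map_inf` — at constant weight `q`, Mathlib's `setBer(Set.univ, q)` on
  `Set ι` (the `setBer(E(G), p)` of the programme's starting statement) is the image of
  `percMeasureInf (fun _ => q)` under `toSetInf ω = {e | ω e = true}`: the two measures are the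
  same object under the canonical bijection between configurations and open-edge sets.

Own work; standard axioms.
-/

namespace Summit.Ventures.PercRepro2

namespace MeasureBridge

open MeasureTheory ProbabilityTheory unitInterval
open scoped ENNReal

variable {ι : Type*}

/-- The product Bernoulli measure on the configurations of an arbitrary edge type `ι`: the edges
are independent, edge `e` open with probability `p e`. -/
noncomputable def percMeasureInf (p : ι → I) : Measure (ι → Bool) :=
  Measure.infinitePi fun e => edgeLaw (p e)

/-- `percMeasureInf p` is a probability measure. -/
instance (p : ι → I) : IsProbabilityMeasure (percMeasureInf p) := by
  unfold percMeasureInf; infer_instance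

/-- On a finite edge type, `percMeasureInf` is the finite product `percMeasure`. -/
theorem percMeasureInf_eq_percMeasure [Fintype ι] (p : ι → I) :
    percMeasureInf p = percMeasure p :=
  Measure.infinitePi_eq_pi _

/-- **Cylinder events**: the configuration on the finite edge set `u` lies in `S` with
probability `prob (fun e : u => p e) S` — the cell's finite sum on the finite graph `u`. -/
theorem percMeasureInf_cylinder [DecidableEq ι] (p : ι → I) (u : Finset ι) (S : Set (Config u)) :
    percMeasureInf p (MeasureTheory.cylinder u S) =
      ENNReal.ofReal (prob (fun e : u => (p e : ℝ)) S) := by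
  rw [percMeasureInf, Measure.infinitePi_cylinder _ MeasurableSet.of_discrete]
  exact percMeasure_apply (fun e : u => p e) S

/-- `Measure.real` form of `percMeasureInf_cylinder`. -/
theorem percMeasureInf_real_cylinder [DecidableEq ι] (p : ι → I) (u : Finset ι)
    (S : Set (Config u)) :
    (percMeasureInf p).real (MeasureTheory.cylinder u S) = prob (fun e : u => (p e : ℝ)) S := by
  rw [measureReal_def, percMeasureInf_cylinder, ENNReal.toReal_ofReal]
  rw [← percMeasure_real_apply]
  exact measureReal_nonneg

/-- **Marginals**: the state of one edge has its Bernoulli law. -/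
theorem map_eval_percMeasureInf (p : ι → I) (e : ι) :
    (percMeasureInf p).map (fun ω : ι → Bool => ω e) = edgeLaw (p e) :=
  (measurePreserving_eval_infinitePi _ e).map_eq

/-- **Independence**: the states of the edges are independent random variables under
`percMeasureInf p`. -/
theorem iIndepFun_percMeasureInf (p : ι → I) :
    iIndepFun (fun e (ω : ι → Bool) => ω e) (percMeasureInf p) := by
  rw [iIndepFun_iff_map_fun_eq_infinitePi_map₀ (by fun_prop)]
  simp only [map_eval_percMeasureInf]
  rw [percMeasureInf]
  exact Measure.map_id

/-! ## Constant weight: Mathlib's `setBer(Set.univ, q)` on an arbitrary edge type -/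

/-- The set of open edges of a configuration on an arbitrary edge type. -/
def toSetInf (ω : ι → Bool) : Set ι := {e | ω e = true}

/-- Membership in `toSetInf`. -/
@[simp] lemma mem_toSetInf {ω : ι → Bool} {e : ι} : e ∈ toSetInf ω ↔ ω e = true := Iff.rfl

/-- The coordinatewise `Bool → Prop` map `ω ↦ (fun e => ω e = true)`. -/
def toPropInf (ω : ι → Bool) : ι → Prop := fun e => ω e = true

/-- `toSetInf` factors through `toPropInf` and `setOf`. -/
lemma toSetInf_eq : (toSetInf : (ι → Bool) → Set ι) = (fun P : ι → Prop => {i | P i}) ∘ toPropInf :=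
  rfl

/-- `toPropInf` is measurable. -/
lemma measurable_toPropInf : Measurable (toPropInf : (ι → Bool) → (ι → Prop)) := by
  unfold toPropInf
  exact measurable_pi_lambda _ fun e =>
    (measurable_of_countable (fun b : Bool => b = true)).comp (measurable_pi_apply e)

/-- `setOf : (ι → Prop) → Set ι` is measurable. -/
lemma measurable_setOf' : Measurable (fun P : ι → Prop => {i | P i}) :=
  MeasurableEquiv.setOf.measurable

/-- The image of the one-edge law `edgeLaw q` under `· = true` is the `Prop`-law `propLaw q`. -/
lemma map_edgeLaw_eq_propLaw (q : I) :
    (edgeLaw q).map (fun b : Bool => b = true) = propLaw q := by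
  have hm : Measurable (fun b : Bool => b = true) := measurable_of_countable _
  rw [edgeLaw, bernoulliMeasure_def, Measure.map_add _ _ hm, Measure.map_smul, Measure.map_smul,
    Measure.map_dirac' hm, Measure.map_dirac' hm, propLaw]
  simp

/-- **Mathlib's set-Bernoulli measure on an arbitrary edge type** is the image of the cell's
product measure `percMeasureInf (fun _ => q)` under `toSetInf`. -/
theorem setBernoulli_univ_eq_map_inf (q : I) :
    setBer((Set.univ : Set ι), q) = (percMeasureInf fun _ => q).map toSetInf := by
  rw [setBernoulli_eq_map, toSetInf_eq, ← Measure.map_map measurable_setOf' measurable_toPropInf,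
    percMeasureInf]
  have h : (toPropInf : (ι → Bool) → (ι → Prop)) =
      fun x i => (fun (_ : ι) (b : Bool) => b = true) i (x i) := rfl
  rw [h, Measure.infinitePi_map_pi (μ := fun _ : ι => edgeLaw q)
    (f := fun (_ : ι) (b : Bool) => b = true) (fun _ => measurable_of_countable _)]
  simp_rw [setBernoulli_law_univ, map_edgeLaw_eq_propLaw]

end MeasureBridge

end Summit.Ventures.PercRepro2
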